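import Summits.QuantumAdvantage.AdviceFreeQNC0.OneSidedWindow
import HarnessLib

/-!
# Cell qa-qnc0 (rung F-Q1, route RingFrame, crux α `RingToElim`): the one-sided fibre identity,
# POINTWISE form — every strategy, no blindness (tool for T9 / K-feature windows)

`OneSidedWindow.lean` proves the one-sided identity `WIN(x, z) = e_x(z) ⊕ B_{2|x|}(z)` for a
window `x ++ h ++ z` whose `z`-interior cuts do not read `x` (one `B` for all `x`).  The same
computation, read for ONE `x` at a time, needs no hypothesis at all:

* `mixedWinU_oneSided_eq_pt` — the window identity with the `z`-interior selectors replaced by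
  any `sz` agreeing with them on the slice of the given `x`;
* `exists_elimWin_oneSided` — for EVERY walk strategy of degree `≤ D`, all outside blocks
  `a, b`, middle block `h` and `x`: `WIN(a ++ x ++ h ++ z ++ b) = e_x(z) ⊕ B^x_{2|x|}(z)` with
  `e_x` an elimination WIN pattern of degree `≤ D` (`IsElimWin`) and `B^x_s(z)` the parity of the
  `z`-interior cuts, selectors read on the slice of `x`, characters
  `c' + 2|h| + g + s + |z| + W_{g−L−H}(z)` (`c' = c + p + 2|a| + |b|`);
* `interiorPat_periodic`, `interiorPat_even` — `B^x` is `3`-periodic and even in `s`.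

So the dependence of the game on the `x`-block is confined to (i) the offset `2|x| mod 3` and
(ii) the restriction of the `z`-interior selectors to the slice of `x` — the handle used by the
K-feature window theorem (`KFeatureWindow.lean`, planner qa-qnc0-p1's T9).  The cell's lemmas
(prover qn-prover-3 gen 4, 2026-08-27); not in print.  WHAT THIS IS NOT: no hardness statement
here; nothing on α; no separation.
-/

noncomputable section

namespace Summit.QuantumAdvantage.AdviceFreeQNC0

open Finset
open Literature.Computability.MetaComplexity Literature.Computability.MetaComplexity.Smolensky

variable {L H M : ℕ}

/-- Parities add. -/
private theorem decide_odd_add₃ (a b : ℕ) :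
    decide ((a + b) % 2 = 1) = xor (decide (a % 2 = 1)) (decide (b % 2 = 1)) := by
  rcases Nat.mod_two_eq_zero_or_one a with ha | ha <;>
    rcases Nat.mod_two_eq_zero_or_one b with hb | hb <;> simp [Nat.add_mod, ha, hb]

/-- Two even triples combine to an even triple. -/
private theorem xor3_pair' : ∀ (p0 p1 p2 a0 a1 a2 : Bool),
    xor p0 (xor p1 p2) = false → xor a0 (xor a1 a2) = false →
    xor (xor p0 a0) (xor (xor p1 a1) (xor p2 a2)) = false := by
  decide

/-! ### The pointwise window identity -/

/-- **One-sided fibre identity (window form, pointwise in `x`).**  As `mixedWinU_oneSided_eq`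
(`OneSidedWindow.lean`), but the `z`-interior selectors are only required to agree with `sz` on
the slice of the GIVEN `x` (so `sz g z := y g (x ++ h ++ z)` is always admissible: no blindness
is assumed).  Mixed game on `L + H + M` bits (charge `c`, outside triple `P`, window strategy `y`)
on the content `x ++ h ++ z`: the win bit is
`(P_{|w| mod 3} ⊕ N_{|z| mod 3}(z)) ⊕ B_{2|x|}(z)`, where `N_r` is the parity of the
non-interior cuts live for the residue `r` (`nonIntChar`) and `B` the parity of the `z`-interior
cuts with character `c + 2|h| + g + 2|x| + |z| + W_{g−L−H}(z)`. -/
theorem mixedWinU_oneSided_eq_pt (c : ℕ) (P : ℕ → (Fin (L + H + M) → Bool) → Bool)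
    (y : Fin (L + H + M + 1) → (Fin (L + H + M) → Bool) → Bool) (h : Fin H → Bool)
    (x : Fin L → Bool) (sz : Fin (L + H + M + 1) → (Fin M → Bool) → Bool)
    (hz : ∀ g : Fin (L + H + M + 1), L + H < g.val → g.val < L + H + M →
      ∀ z : Fin M → Bool, y g (glue3 x h z) = sz g z)
    (z : Fin M → Bool) :
    mixedWinU c P y (glue3 x h z) =
      xor (xor (P ((wt x + wt h + wt z % 3) % 3) (glue3 x h z))
            (decide ((((univ : Finset (Fin (L + H + M + 1))).filter fun g =>
                ¬ (L + H < g.val ∧ g.val < L + H + M)).filter fun g =>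
                (y g (glue3 x h z) && decide (nonIntChar L H c x h g.val (wt z % 3) % 3 ≠ 0))
                  = true).card % 2 = 1)))
        (decide ((((univ : Finset (Fin (L + H + M + 1))).filter fun g =>
              L + H < g.val ∧ g.val < L + H + M).filter fun g =>
              (sz g z && decide ((c + 2 * wt h + g.val + 2 * wt x + wt z
                + wtPrefix z (g.val - (L + H))) % 3 ≠ 0)) = true).card % 2 = 1)) := by
  classical
  set w := glue3 x h z with hw
  have hwt : wt w = wt x + wt h + wt z := wt_glue3 x h z
  set S := univ.filter fun g : Fin (L + H + M + 1) =>
    y g w = true ∧ (c + g.val + walkExp w g.val) % 3 ≠ 0 with hS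
  have hsplit : S.card = (S.filter fun g => ¬ (L + H < g.val ∧ g.val < L + H + M)).card
      + (S.filter fun g => L + H < g.val ∧ g.val < L + H + M).card := by
    have hc := Finset.card_filter_add_card_filter_not (s := S)
      (fun g : Fin (L + H + M + 1) => L + H < g.val ∧ g.val < L + H + M)
    omega
  -- non-interior cuts: the character depends on `z` through `|z| mod 3`
  have hN : (S.filter fun g => ¬ (L + H < g.val ∧ g.val < L + H + M)) =
      ((univ : Finset (Fin (L + H + M + 1))).filter fun g =>
        ¬ (L + H < g.val ∧ g.val < L + H + M)).filter fun g =>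
        (y g w && decide (nonIntChar L H c x h g.val (wt z % 3) % 3 ≠ 0)) = true := by
    rw [hS, Finset.filter_filter, Finset.filter_filter]
    refine Finset.filter_congr fun g _ => ?_
    have hchar : ¬ (L + H < g.val ∧ g.val < L + H + M) →
        (c + g.val + walkExp w g.val) % 3 = nonIntChar L H c x h g.val (wt z % 3) % 3 := by
      intro hng
      have hg := g.isLt
      unfold walkExp nonIntChar
      by_cases h1 : g.val < L
      · rw [if_pos h1, hwt, hw, wtPrefix_glue3_of_le x h z (by omega : g.val ≤ L)]
        omega
      · rw [if_neg h1]
        by_cases h2 : g.val ≤ L + H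
        · rw [if_pos h2, hwt]
          have hWg : wtPrefix w g.val = wt x + wtPrefix h (g.val - L) := by
            obtain ⟨d, hd⟩ : ∃ d, g.val = L + d := ⟨g.val - L, by omega⟩
            rw [hw, hd, wtPrefix_glue3_window x h z (by omega : d ≤ H), Nat.add_sub_cancel_left]
          rw [hWg]
          omega
        · rw [if_neg h2, hwt]
          have hgE : g.val = L + H + M := by omega
          rw [hgE, hw, wtPrefix_of_length_le (glue3 x h z) le_rfl, wt_glue3]
          omega
    constructor
    · rintro ⟨⟨h1, h2⟩, h3⟩
      refine ⟨h3, ?_⟩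
      rw [h1, ← hchar h3]
      simp [h2]
    · rintro ⟨h3, h4⟩
      refine ⟨⟨?_, ?_⟩, h3⟩
      · revert h4; cases y g w <;> simp
      · rw [hchar h3]; revert h4; cases y g w <;> simp
  -- interior cuts
  have hB : (S.filter fun g => L + H < g.val ∧ g.val < L + H + M) =
      ((univ : Finset (Fin (L + H + M + 1))).filter fun g =>
        L + H < g.val ∧ g.val < L + H + M).filter fun g =>
        (sz g z && decide ((c + 2 * wt h + g.val + 2 * wt x + wt z
          + wtPrefix z (g.val - (L + H))) % 3 ≠ 0)) = true := by
    rw [hS, Finset.filter_filter, Finset.filter_filter]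
    refine Finset.filter_congr fun g _ => ?_
    have hpre : L + H < g.val → g.val < L + H + M → (c + g.val + walkExp w g.val) % 3 =
        (c + 2 * wt h + g.val + 2 * wt x + wt z + wtPrefix z (g.val - (L + H))) % 3 := by
      intro h1 h2
      unfold walkExp
      rw [hwt, hw, wtPrefix_glue3_of_ge x h z (by omega : L + H ≤ g.val)]
      omega
    constructor
    · rintro ⟨⟨h1, h2⟩, h3, h4⟩
      refine ⟨⟨h3, h4⟩, ?_⟩
      rw [← hz g h3 h4 z, ← hw, h1, ← hpre h3 h4]
      simp [h2]
    · rintro ⟨⟨h3, h4⟩, h5⟩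
      rw [← hz g h3 h4 z, ← hw] at h5
      refine ⟨⟨?_, ?_⟩, h3, h4⟩
      · revert h5; cases y g w <;> simp
      · rw [hpre h3 h4]; revert h5; cases y g w <;> simp
  -- assemble
  have hPidx : wt w % 3 = (wt x + wt h + wt z % 3) % 3 := by rw [hwt]; omega
  unfold mixedWinU ringWinU
  rw [hPidx, ← hS, hsplit, decide_odd_add₃, hN, hB]
  generalize P ((wt x + wt h + wt z % 3) % 3) w = bP
  generalize decide ((((univ : Finset (Fin (L + H + M + 1))).filter fun g =>
      ¬ (L + H < g.val ∧ g.val < L + H + M)).filter fun g =>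
      (y g w && decide (nonIntChar L H c x h g.val (wt z % 3) % 3 ≠ 0)) = true).card % 2 = 1) = bN
  generalize decide ((((univ : Finset (Fin (L + H + M + 1))).filter fun g =>
      L + H < g.val ∧ g.val < L + H + M).filter fun g =>
      (sz g z && decide ((c + 2 * wt h + g.val + 2 * wt x + wt z
        + wtPrefix z (g.val - (L + H))) % 3 ≠ 0)) = true).card % 2 = 1) = bB
  cases bP <;> cases bN <;> cases bB <;> rfl

/-! ### The interior pattern of a slice -/

variable {p q : ℕ}

/-- `B^x_s(z)`: the parity of the `z`-interior cuts of the window, selectors read on the slice of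
`x`, characters shifted by `s`. -/
def interiorPat (c : ℕ) (y : Fin (p + (L + H + M) + q + 1) → (Fin (p + (L + H + M) + q) → Bool) → Bool)
    (a : Fin p → Bool) (h : Fin H → Bool) (b : Fin q → Bool) (x : Fin L → Bool) (s : ℕ)
    (z : Fin M → Bool) : Bool :=
  decide ((((univ : Finset (Fin (L + H + M + 1))).filter fun g =>
    L + H < g.val ∧ g.val < L + H + M).filter fun g =>
    (inStrategy y a b g (glue3 x h z) && decide ((inCharge c a b + 2 * wt h + g.val + s + wt z
      + wtPrefix z (g.val - (L + H))) % 3 ≠ 0)) = true).card % 2 = 1)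

/-- `B^x` is `3`-periodic in the shift. -/
theorem interiorPat_periodic (c : ℕ)
    (y : Fin (p + (L + H + M) + q + 1) → (Fin (p + (L + H + M) + q) → Bool) → Bool)
    (a : Fin p → Bool) (h : Fin H → Bool) (b : Fin q → Bool) (x : Fin L → Bool) (s : ℕ)
    (z : Fin M → Bool) : interiorPat c y a h b x (s + 3) z = interiorPat c y a h b x s z := by
  unfold interiorPat
  refine congrArg (fun S : Finset (Fin (L + H + M + 1)) => decide (S.card % 2 = 1))
    (Finset.filter_congr fun g _ => ?_)
  rw [show (inCharge c a b + 2 * wt h + g.val + (s + 3) + wt z + wtPrefix z (g.val - (L + H))) % 3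
    = (inCharge c a b + 2 * wt h + g.val + s + wt z + wtPrefix z (g.val - (L + H))) % 3 by omega]

/-- `B^x` depends on the shift only mod `3`. -/
theorem interiorPat_mod (c : ℕ)
    (y : Fin (p + (L + H + M) + q + 1) → (Fin (p + (L + H + M) + q) → Bool) → Bool)
    (a : Fin p → Bool) (h : Fin H → Bool) (b : Fin q → Bool) (x : Fin L → Bool) (s : ℕ)
    (z : Fin M → Bool) : interiorPat c y a h b x s z = interiorPat c y a h b x (s % 3) z := by
  unfold interiorPat
  refine congrArg (fun S : Finset (Fin (L + H + M + 1)) => decide (S.card % 2 = 1))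
    (Finset.filter_congr fun g _ => ?_)
  rw [show (inCharge c a b + 2 * wt h + g.val + s + wt z + wtPrefix z (g.val - (L + H))) % 3
    = (inCharge c a b + 2 * wt h + g.val + s % 3 + wt z + wtPrefix z (g.val - (L + H))) % 3 by omega]

/-- `B^x` is even in the shift: each interior cut is live for exactly two shifts. -/
theorem interiorPat_even (c : ℕ)
    (y : Fin (p + (L + H + M) + q + 1) → (Fin (p + (L + H + M) + q) → Bool) → Bool)
    (a : Fin p → Bool) (h : Fin H → Bool) (b : Fin q → Bool) (x : Fin L → Bool) (s : ℕ)
    (z : Fin M → Bool) :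
    xor (interiorPat c y a h b x s z) (xor (interiorPat c y a h b x (s + 1) z)
      (interiorPat c y a h b x (s + 2) z)) = false := by
  unfold interiorPat
  exact xor3_parity_of_pointwise _ (fun g => inStrategy y a b g (glue3 x h z))
    (fun g => decide ((inCharge c a b + 2 * wt h + g.val + s + wt z
      + wtPrefix z (g.val - (L + H))) % 3 ≠ 0))
    (fun g => decide ((inCharge c a b + 2 * wt h + g.val + (s + 1) + wt z
      + wtPrefix z (g.val - (L + H))) % 3 ≠ 0))
    (fun g => decide ((inCharge c a b + 2 * wt h + g.val + (s + 2) + wt z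
      + wtPrefix z (g.val - (L + H))) % 3 ≠ 0))
    (fun g => xor3_decide_mod3' _ _ _ (by omega) (by omega) (by omega))

/-- `B^x` depends on `x` only through the slice of the `z`-interior selectors. -/
theorem interiorPat_congr (c : ℕ)
    (y : Fin (p + (L + H + M) + q + 1) → (Fin (p + (L + H + M) + q) → Bool) → Bool)
    (a : Fin p → Bool) (h : Fin H → Bool) (b : Fin q → Bool) {x x' : Fin L → Bool}
    (hxx' : ∀ g : Fin (p + (L + H + M) + q + 1), p + (L + H) < g.val → g.val < p + (L + H + M) →
      ∀ z : Fin M → Bool, y g (glue3 a (glue3 x h z) b) = y g (glue3 a (glue3 x' h z) b))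
    (s : ℕ) (z : Fin M → Bool) : interiorPat c y a h b x s z = interiorPat c y a h b x' s z := by
  unfold interiorPat
  refine congrArg (fun S : Finset (Fin (L + H + M + 1)) => decide (S.card % 2 = 1))
    (Finset.filter_congr fun g hg => ?_)
  have hg' := (Finset.mem_filter.1 hg).2
  unfold inStrategy
  rw [hxx' ⟨p + g.val, by omega⟩ (show p + (L + H) < p + g.val by omega)
    (show p + g.val < p + (L + H + M) by omega) z]

/-- **The one-sided identity for every strategy.**  For a walk strategy of degree `≤ D` on
`p + (L + H + M) + q` bits, every fibre `(a, h, b)` and every `x`: the `z`-pattern of WIN is an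
elimination win pattern `e_x` of degree `≤ D` XOR the interior pattern `B^x_{2|x|}`. -/
theorem exists_elimWin_oneSided {D : ℕ} (c : ℕ)
    (y : Fin (p + (L + H + M) + q + 1) → (Fin (p + (L + H + M) + q) → Bool) → Bool)
    (hdeg : ∀ g, HasDeg (y g) D) (a : Fin p → Bool) (h : Fin H → Bool) (b : Fin q → Bool)
    (x : Fin L → Bool) :
    ∃ e : (Fin M → Bool) → Bool, IsElimWin D e ∧
      ∀ z : Fin M → Bool, ringWinU c y (glue3 a (glue3 x h z) b) =
        xor (e z) (interiorPat c y a h b x (2 * wt x) z) := by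
  classical
  set T : ℕ → (Fin M → Bool) → Bool := fun r z =>
    xor (outParity y c a b ((wt x + wt h + r) % 3) (glue3 x h z))
      (decide ((((univ : Finset (Fin (L + H + M + 1))).filter fun g =>
        ¬ (L + H < g.val ∧ g.val < L + H + M)).filter fun g =>
        (inStrategy y a b g (glue3 x h z) &&
          decide (nonIntChar L H (inCharge c a b) x h g.val r % 3 ≠ 0)) = true).card % 2 = 1))
    with hT
  have hTdeg : ∀ r, HasDeg (T r) D := by
    intro r
    refine hasDeg_xor (hasDeg_append_right (Fin.append x h) (hasDeg_outParity c y hdeg a b _)) ?_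
    exact hasDeg_parity _ (fun g (z : Fin M → Bool) => inStrategy y a b g (glue3 x h z) &&
        decide (nonIntChar L H (inCharge c a b) x h g.val r % 3 ≠ 0))
      fun g _ => hasDeg_and_const'
        (hasDeg_append_right (Fin.append x h) (hasDeg_inStrategy y hdeg a b g)) _
  have hTeven : ∀ z, xor (T 0 z) (xor (T 1 z) (T 2 z)) = false := by
    intro z
    have hP := xor3_perm (fun r => outParity y c a b r (glue3 x h z)) (outParity_even c y a b _)
      (wt x + wt h + 0) (wt x + wt h + 1) (wt x + wt h + 2) (by omega) (by omega) (by omega)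
    have hNp := xor3_parity_of_pointwise (((univ : Finset (Fin (L + H + M + 1))).filter fun g =>
        ¬ (L + H < g.val ∧ g.val < L + H + M)))
      (fun g => inStrategy y a b g (glue3 x h z))
      (fun g => decide (nonIntChar L H (inCharge c a b) x h g.val 0 % 3 ≠ 0))
      (fun g => decide (nonIntChar L H (inCharge c a b) x h g.val 1 % 3 ≠ 0))
      (fun g => decide (nonIntChar L H (inCharge c a b) x h g.val 2 % 3 ≠ 0))
      (fun g => nonIntChar_xor3 L H (inCharge c a b) x h g.val)
    exact xor3_pair' _ _ _ _ _ _ hP hNp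
  have hF : IsElimFail D (fun z => !(T (wt z % 3) z)) :=
    (failCompl_iff_evenTriple M D _).2 ⟨T, ⟨hTdeg, hTeven⟩, fun z => rfl⟩
  obtain ⟨c₀, a', b', ha', hb', hFe⟩ := hF
  refine ⟨fun z => T (wt z % 3) z, ⟨c₀, a', b', ha', hb', fun z => ?_⟩, fun z => ?_⟩
  · rw [← hFe z, Bool.not_not]
  · rw [ringWinU_glue3_eq_mixedWinU c y a (glue3 x h z) b,
      mixedWinU_oneSided_eq_pt (inCharge c a b) (outParity y c a b) (inStrategy y a b) h x
        (fun g z => inStrategy y a b g (glue3 x h z)) (fun _ _ _ _ => rfl) z]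
    rfl

end Summit.QuantumAdvantage.AdviceFreeQNC0
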